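import Literature.Probability.LatticeModels.FKIsingQuadrilateralCrossingProofs
import Literature.Probability.RandomPlanarGeometry.ChordalBoundary
import HarnessLib

/-!
# Chelkak–Smirnov's crossing theorem: normalising the uniformizing map to `(ℍ; 0, 1-u, 1, ∞)`

Sibling of `Literature.Probability.LatticeModels.FKIsingQuadrilateralCrossing` (the named fact
`ChelkakSmirnov2012_fkIsingQuadrilateralCrossing`, D. Chelkak, S. Smirnov, Invent. Math. 189 (2012),
Thm. 6.1, square lattice) and of `FKIsingQuadrilateralCrossingProofs.lean`. The tree's statement
quantifies over a conformal map `φ : ℍ → Ω^δ` with boundary values the four marked corners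
`csCorner 0, 1, 2, 3` (the paper's `b, c, d, a`) at real points `x₀ < x₁ < x₂ < x₃`, and the limit
is `p(crossRatio x)`; the proof bricks of the `HalfPlane` section of the proofs file (and the
reduction `chelkakSmirnov2012_of_halfPlaneLimit`) live on the NORMALISED quadrilateral
`(ℍ; a, b, c, d) = (ℍ; 0, 1-u, 1, ∞)` of the paper's closing computation. This file supplies the
normalisation (Ahlfors, Ch. 3 §3.1: a real Möbius map is determined by three points, the
cross-ratio is invariant), everything proved:

* `hasBoundaryValueAtInfty_realMobius_trans` — boundary value at `∞` of `ψ ∘ M` for a real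
  Möbius self-map `M` of `ℍ` with `c ≠ 0`: it is the boundary value of `ψ` at `M(∞) = a/c`
  (complement to `ConformalEquiv.hasBoundaryValue_realMobius_trans(_pole)` of `ChordalBoundary.lean`);
* `exists_normalised_uniformizer` — from `φ : ℍ → U` with boundary values `p j` at `x j`,
  `x` strictly monotone, the map `ψ = φ ∘ N`, `N(w) = (x₂ w - k x₃)/(w - k)`,
  `k = (x₁ - x₂)/(x₁ - x₃)`, is a conformal map `ℍ → U` with boundary values `p 3` at `0`,
  `p 0` at `1 - crossRatio x`, `p 1` at `1` and `p 2` at `∞`: the marked quadrilateral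
  `(U; p 3, p 0, p 1, p 2) = (U; a, b, c, d)` is conformally `(ℍ; 0, 1-u, 1, ∞)` with
  `u = crossRatio x`, as asserted in the module docstring of the statement file;
* `exists_normalised_uniformizer_of_strictAnti` — the strictly antitone case of the statement
  normalises the same way with the labels reversed (`crossRatio_rev` of `ConformalRectangle.lean`).

## References
* [ChelkakSmirnov2012Ising] D. Chelkak, S. Smirnov, Invent. Math. 189 (2012), §6 Thm. 6.1 and the
  closing half-plane computation of its proof (arXiv:0910.2045 p. 28; READ).
* [AhlforsCA1979] L. V. Ahlfors, *Complex Analysis*, 3rd ed. (1979), Ch. 3 §3.1.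
-/

noncomputable section

open Filter Set Complex
open scoped Topology

namespace Literature.Probability.LatticeModels

open Literature.Probability.RandomPlanarGeometry (ConformalEquiv crossRatio)
open Literature.Probability.RandomPlanarGeometry.ConformalEquiv (realMobius realMobius_apply
  hasBoundaryValue_realMobius_trans)
open UpperHalfPlane (upperHalfPlaneSet)

/-- **Boundary value at infinity of `ψ ∘ M`** for a real Möbius self-map `M(z) = (az+b)/(cz+d)`
of `ℍ` with `c ≠ 0`: since `M(z) → a/c` as `z → ∞` (inside `ℍ`), it is the boundary value of `ψ`
at the real point `a/c`. [folklore] -/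
theorem hasBoundaryValueAtInfty_realMobius_trans {a b c d : ℝ} (hdet : 0 < a * d - b * c)
    (hc : c ≠ 0) {V : Set ℂ} (ψ : ConformalEquiv upperHalfPlaneSet V) {p : ℂ}
    (hψ : ψ.HasBoundaryValue ((a / c : ℝ) : ℂ) p) :
    ((realMobius a b c d hdet).trans ψ).HasBoundaryValueAtInfty p := by
  have hC : (c : ℂ) ≠ 0 := by exact_mod_cast hc
  -- `M z = a/c + K/(z - e)` with `K = (bc - ad)/c²`, `e = -d/c`
  set K : ℂ := ((b : ℂ) * c - a * d) / c ^ 2 with hK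
  set e : ℂ := -(d : ℂ) / c with he
  have hden : ∀ z : ℂ, (c : ℂ) * z + d = c * (z - e) := by
    intro z; rw [he]; field_simp; ring
  have key : ∀ z : ℂ, (c : ℂ) * z + d ≠ 0 →
      ((a : ℂ) * z + b) / (c * z + d) = (a : ℂ) / c + K / (z - e) := by
    intro z hz
    have hze : z - e ≠ 0 := by
      intro h; apply hz; rw [hden, h, mul_zero]
    rw [div_add_div _ _ hC hze, div_eq_div_iff hz (mul_ne_zero hC hze), hK, he]
    field_simp
    ring
  have hM : Tendsto (fun z : ℂ ↦ ((a : ℂ) * z + b) / (c * z + d))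
      (cocompact ℂ ⊓ 𝓟 upperHalfPlaneSet) (𝓝 ((a / c : ℝ) : ℂ)) := by
    have h0 := (tendsto_const_div_sub_cocompact K e).mono_left
      (inf_le_left (b := 𝓟 upperHalfPlaneSet))
    have h1 := (tendsto_const_nhds (x := (a : ℂ) / c)).add h0
    rw [add_zero] at h1
    have hac : ((a / c : ℝ) : ℂ) = (a : ℂ) / c := by push_cast; rfl
    rw [hac]
    refine h1.congr' ?_
    rw [EventuallyEq, eventually_inf_principal]
    refine Eventually.of_forall fun z hz ↦ (key z ?_).symm
    intro h
    have him : ((c : ℂ) * z + d).im = 0 := by rw [h]; simp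
    simp only [add_im, mul_im, ofReal_re, ofReal_im, zero_mul, add_zero] at him
    exact (mul_ne_zero hc (ne_of_gt (show (0 : ℝ) < z.im from hz))) him
  have hmaps : ∀ᶠ z in cocompact ℂ ⊓ 𝓟 upperHalfPlaneSet,
      ((a : ℂ) * z + b) / (c * z + d) ∈ upperHalfPlaneSet := by
    rw [eventually_inf_principal]
    refine Eventually.of_forall fun z hz ↦ ?_
    have := (realMobius a b c d hdet).mapsTo hz
    rwa [realMobius_apply] at this
  have hM' : Tendsto (fun z : ℂ ↦ ((a : ℂ) * z + b) / (c * z + d))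
      (cocompact ℂ ⊓ 𝓟 upperHalfPlaneSet) (𝓝[upperHalfPlaneSet] ((a / c : ℝ) : ℂ)) :=
    tendsto_nhdsWithin_iff.2 ⟨hM, hmaps⟩
  have h := hψ.comp hM'
  refine h.congr fun z ↦ ?_
  have hz : (realMobius a b c d hdet) z = ((a : ℂ) * z + b) / (c * z + d) := realMobius_apply a b c d hdet z
  rw [Function.comp_apply, ConformalEquiv.trans_apply, hz]

/-- **Normalising the uniformizing map (three points and the cross-ratio).** Let `φ : ℍ → U` be a
conformal equivalence with boundary values `p j` at strictly increasing real points `x j`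
(`j = 0, 1, 2, 3`). With `k = (x₁ - x₂)/(x₁ - x₃) > 0` and the real Möbius self-map
`N(w) = (x₂ w - k x₃)/(w - k)` of `ℍ` (`N(0) = x₃`, `N(1) = x₁`, `N(∞) = x₂`,
`N(1 - crossRatio x) = x₀`), the map `ψ = φ ∘ N : ℍ → U` has boundary values `p 3` at `0`, `p 0`
at `1 - crossRatio x`, `p 1` at `1` and `p 2` at `∞`. For the statement of Thm. 6.1
(`p j = ` the corner `csCorner j`, i.e. `(p 3, p 0, p 1, p 2) = (a, b, c, d)`) this realises the
marked quadrilateral as `(ℍ; 0, 1-u, 1, ∞)`, `u = crossRatio x`, the normal form of the paper's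
closing computation and of the `HalfPlane` bricks. [cite: ChelkakSmirnov2012Ising, §6, proof of
Thm. 6.1 ("the half-plane (ℍ; 0, 1-u, 1, ∞)"); AhlforsCA1979, Ch. 3 §3.1] -/
theorem exists_normalised_uniformizer {U : Set ℂ} (φ : ConformalEquiv upperHalfPlaneSet U)
    {x : Fin 4 → ℝ} (hx : StrictMono x) {p : Fin 4 → ℂ}
    (hbv : ∀ j : Fin 4, φ.HasBoundaryValue (x j) (p j)) :
    ∃ ψ : ConformalEquiv upperHalfPlaneSet U,
      ψ.HasBoundaryValue 0 (p 3) ∧ ψ.HasBoundaryValue ((1 - crossRatio x : ℝ) : ℂ) (p 0) ∧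
        ψ.HasBoundaryValue 1 (p 1) ∧ ψ.HasBoundaryValueAtInfty (p 2) ∧
        ∀ w : ℂ, ψ w =
          φ ((x 2 * w - (x 1 - x 2) / (x 1 - x 3) * x 3) / (w - (x 1 - x 2) / (x 1 - x 3))) := by
  have h01 : x 0 < x 1 := hx (by decide)
  have h12 : x 1 < x 2 := hx (by decide)
  have h23 : x 2 < x 3 := hx (by decide)
  have h13 : x 1 - x 3 ≠ 0 := by linarith
  have h02 : x 0 - x 2 ≠ 0 := by linarith
  have h23' : x 2 - x 3 ≠ 0 := by linarith
  have h12' : x 1 - x 2 ≠ 0 := by linarith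
  set k : ℝ := (x 1 - x 2) / (x 1 - x 3) with hk
  have hk0 : 0 < k := div_pos_of_neg_of_neg (by linarith) (by linarith)
  -- `N = realMobius (x 2) (-k x₃) 1 (-k)`, determinant `k (x₃ - x₂) > 0`
  have hdet : 0 < x 2 * (-k) - (-k * x 3) * 1 := by nlinarith
  set N := realMobius (x 2) (-k * x 3) 1 (-k) hdet with hN
  -- the three regular values of `N` and the cross-ratio identity
  have hu : 1 - crossRatio x = (x 0 - x 3) * (x 1 - x 2) / ((x 0 - x 2) * (x 1 - x 3)) := by
    unfold crossRatio
    field_simp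
    ring
  have hN0 : ((x 2 * (0 : ℝ) + -k * x 3) / (1 * 0 + -k) : ℝ) = x 3 := by
    rw [mul_zero, zero_add, mul_zero, zero_add, neg_mul, neg_div_neg_eq, mul_div_cancel_left₀ _ hk0.ne']
  have hden1 : (1 : ℝ) * 1 + -k = (x 2 - x 3) / (x 1 - x 3) := by
    rw [hk]; field_simp; ring
  have hne1 : (1 : ℝ) * 1 + -k ≠ 0 := by rw [hden1]; exact div_ne_zero h23' h13
  have hN1 : ((x 2 * (1 : ℝ) + -k * x 3) / (1 * 1 + -k) : ℝ) = x 1 := by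
    rw [div_eq_iff hne1, hden1, hk]; field_simp; ring
  have hdenu : (1 : ℝ) * (1 - crossRatio x) + -k = (x 1 - x 2) * (x 2 - x 3) / ((x 1 - x 3) * (x 0 - x 2)) := by
    rw [hu, hk]; field_simp; ring
  have hneu : (1 : ℝ) * (1 - crossRatio x) + -k ≠ 0 := by
    rw [hdenu]; exact div_ne_zero (mul_ne_zero h12' h23') (mul_ne_zero h13 h02)
  have hNu : ((x 2 * (1 - crossRatio x) + -k * x 3) / (1 * (1 - crossRatio x) + -k) : ℝ) = x 0 := by
    rw [div_eq_iff hneu, hdenu, hu, hk]; field_simp; ring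
  refine ⟨N.trans φ, ?_, ?_, ?_, ?_, fun w ↦ ?_⟩
  · -- at `0`: `N 0 = x₃`
    refine hasBoundaryValue_realMobius_trans hdet φ (x := 0) (by simp [hk0.ne']) ?_
    rw [hN0]; exact hbv 3
  · -- at `1 - u`: `N (1 - u) = x₀`
    refine hasBoundaryValue_realMobius_trans hdet φ (x := 1 - crossRatio x) hneu ?_
    rw [hNu]; exact hbv 0
  · -- at `1`: `N 1 = x₁`
    refine hasBoundaryValue_realMobius_trans hdet φ (x := 1) hne1 ?_
    rw [hN1]; exact hbv 1
  · -- at `∞`: `N ∞ = x₂`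
    refine hasBoundaryValueAtInfty_realMobius_trans hdet one_ne_zero φ ?_
    rw [div_one]; exact hbv 2
  · rw [ConformalEquiv.trans_apply, hN, realMobius_apply, hk]
    push_cast
    ring_nf

/-- The antitone case: reversing the order (`x ∘ Fin.rev`) of four strictly antitone points
gives strictly monotone points with the same cross-ratio (`crossRatio_rev`), to which
`exists_normalised_uniformizer` applies; the marked points then appear in the reversed order
`(p 0, p 3, p 2, p 1)` at `(0, 1-u, 1, ∞)`. [folklore] -/
theorem exists_normalised_uniformizer_of_strictAnti {U : Set ℂ}
    (φ : ConformalEquiv upperHalfPlaneSet U) {x : Fin 4 → ℝ} (hx : StrictAnti x) {p : Fin 4 → ℂ}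
    (hbv : ∀ j : Fin 4, φ.HasBoundaryValue (x j) (p j)) :
    ∃ ψ : ConformalEquiv upperHalfPlaneSet U,
      ψ.HasBoundaryValue 0 (p 0) ∧ ψ.HasBoundaryValue ((1 - crossRatio x : ℝ) : ℂ) (p 3) ∧
        ψ.HasBoundaryValue 1 (p 2) ∧ ψ.HasBoundaryValueAtInfty (p 1) := by
  have hx' : StrictMono (x ∘ Fin.rev) := fun i j hij ↦ hx (Fin.rev_lt_rev.2 hij)
  obtain ⟨ψ, h0, hb, h1, hinf, -⟩ :=
    exists_normalised_uniformizer φ hx' (p := p ∘ Fin.rev) (fun j ↦ hbv (Fin.rev j))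
  rw [Literature.Probability.RandomPlanarGeometry.crossRatio_rev] at hb
  exact ⟨ψ, h0, hb, h1, hinf⟩

end Literature.Probability.LatticeModels
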